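import Literature.AnabelianGeometry.EtaleTheta.Discharge.Sec5OfConnectedTemperoid
import Literature.AnabelianGeometry.EtaleTheta.Discharge.Sec4GaloisSurjLawsConnectedModel
import Literature.AnabelianGeometry.SemiGraphs.TemperedPolish

/-!
# [EtTh] §4 setting over the connected temperoid `B^temp(G)⁰` of a tempered QUOTIENT `φ : Π^tp_X ↠ G` (Def. 4.1 pp.312–313, §5 p.330 / PDF pp.86–87, 104)

Mochizuki, *The étale theta function …*, Publ. RIMS **45** (2009)
[cite: MochizukiEtTh2009, Def 4.1 p.312–313 (PDF pp.86–87); §5 p.330 (PDF p.104)];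
Mochizuki, *Semi-graphs of anabelioids*, Publ. RIMS **42** (2006), Rmk. 3.1.2 pp.33–34 (a continuous homomorphism
`Π → Π'` of tempered groups induces `B^temp(Π') → B^temp(Π)`), Rmk. 3.1.3 p.34 (Galois objects `Π/N`, `Aut(Π/N) = Π/N`)
[cite: MochizukiSemiAnbd2006, Rmk 3.1.2 p.33–34; Rmk 3.1.3 p.34].  PAGE CONVENTION for [EtTh]: «printed N (PDF p.M)», N = M + 226.

abc-iut cell, layer L2, seat abc-iut-L2-t3 (gen 9; [EtTh] §3/§4 lineage), ROW R1114 «R-α1 QUOTIENT-BASE §5 SETTING» = bridge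
(J3a) of the sizing memo `HOME/staging/L2/L2-t3/g8/SIZING-Sec5JunctionAtThetaTwistTower-L2t3g8.md` (finding F-L2t3g8-1, adopted by
abc-iut-L2-lead R1114); FILE 1 of 2 (the SETTING; file 2 `Discharge/Sec5OfQuotientTemperoidData.lean` = the §5 data over it).
ADDITIVE: no landed declaration is touched; cc abc-iut-L2-t4 / abc-iut-L2-t11 (junction authors), abc-iut-L2-d2 (the intended instance).

WHY.  The §5 junction of record (`Discharge/Sec5OfConnectedTemperoid.lean`, `Discharge/Sec5OfThetaSetting.lean`) consumes a tempered
Frobenioid `tf : TemperedFrobenioid T₀ (ConnectedPart (BTemp X.Pi)) VD` over the GENUINE connected temperoid `B^temp(Π^tp_X)⁰` of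
`X : TemperedArithmeticGroup K`, whereas every multi-level class-(b) model of Def. 3.6 (ii) in the tree (Kummer–Tate tower
p468928, ζ-twist tower p481604/p482079, the `(β)` `Ÿ`-tower with cusps, theta, E2 roots and A10 — `ThetaTwistTowerTempered.temperedFrobenioid`,
p493549) lives over `B^temp(G)⁰` for the ABSTRACT group `G = Compat₃′` through which `Π^tp_X̲̲` acts on the tower's functions.
`BiKummerSetting X T₀ D VD` (abc-iut-L2-t3, Def. 4.1) has the base `D` FREE and sees `X` only through the Galois surjections
`galoisSurj : Π^tp_X ↠ Aut_D(A)` of Def. 4.1 (ii); so the §4 setting over `D := B^temp(G)⁰` for ANY tempered `G` receiving a continuous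
SURJECTION `φ : Π^tp_X ↠ G` is obtained by precomposing with `φ` the canonical Galois surjections of `B^temp(G)⁰` ([SemiAnbd] Rmk. 3.1.3;
abc-iut-w5-d013's `galoisSurjOf`, read on the connected part by abc-iut-w4-d099's `galoisSurjOf_connectedPart_*`) — print's
"`Π^tp_X ↠ Aut_D(A^bs)`" for the Galois object `G/N ↦ Π^tp_X/φ⁻¹(N)` of the pull-back `B^temp(G)⁰ ↪ B^temp(Π^tp_X)⁰` along `φ`
([SemiAnbd] Rmk. 3.1.2; fully faithful onto the `Ker φ`-trivialised coverings).  This file: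
* `BiKummerSetting.mkOfQuotientTemperoid X hG φ hφ tf …` — abc-iut-L2-t9's GENERIC `mkOfModelCanonical` over `B^temp(G)⁰` with Galois
  objects := those whose underlying `G`-set is Galois and `galoisSurj A := galoisSurjOf⁰_A ∘ φ`; laws `…_galoisSurj_natural`
  (`GaloisSurjNatural` — `φ` SURJECTIVE lifts the inner conjugator), `…_isOpen_ker_galoisSurj` (`IsOpenKerGaloisSurj` — `φ` continuous),
  `mem_Hodot_mkOfQuotientTemperoid_iff` (`H_⊙ = φ⁻¹(Stab)`), `…_galoisHomTorsor` (law (L1)); DICTIONARY `mkOfQuotientTemperoid_id`: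
  at `G := Π^tp_X`, `φ := id` it IS abc-iut-L2-t4's `mkOfConnectedTemperoid` (`rfl`);
* the canonical `A_⊙ := (G/M, 0)` (`TemperedFrobenioid.quotConnZeroObj`; [FrdI] Thm. 5.2: Frobenius-trivial), `mkOfQuotientTemperoidQuot`
  with **`H_⊙ = φ⁻¹(M)`**, and the §5 binder `hH` (`Π^tp_Ÿ ⊆ H_⊙`) whenever `φ(ιX(Π^tp_Ÿ)) ⊆ M`;
* the §5 choice `M := φ(ιX(Π^tp_Ÿ))` (`yddImage`; normal since `φ` is onto; OPEN: input `hopenY`, DISCHARGED by the tree's open mapping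
  theorem for first-countable tempered groups `IsTempered.isOpenMap_of_surjective_of_isTempered` — `isOpen_yddImage_of_firstCountable`),
  `mkOfQuotientTemperoidYdd` with **`hH` a THEOREM** (`hH_mkOfQuotientTemperoidYdd`) and `Ker φ ⊆ H_⊙` (the honest content of re-basing:
  the setting only sees `Π^tp_X` through `G`).
INTENDED INSTANCE (abc-iut-L2-d2 / the junction authors, NOT done here): `G := Compat 3 thetaShear` (`isTempered_compat₃'`, p483372),
`tf := ThetaTwistTowerTempered.temperedFrobenioid R S` (p493549).  HONEST COST, recorded not hidden (memo (J3b)): the homomorphism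
`φ : Π^tp_X̲̲ → Compat₃′`, `g ↦ ((κ_ϖ, κ_Ü, κ_Θ̈)(g), χ(g), γ(g))`, is NOT in the tree as a compatible system of Kummer classes, and it is
NOT onto (`χ(G_K) ⊊ Ẑˣ`) — so that instance is over `G := Im φ` (closed ⇒ tempered: `IsTempered.subgroup_of_isClosed`; the tower's
restriction to it is a separate row) or over `Compat₃′` with a surjection as hypothesis.  Here `G`, `φ` are parameters.
HONEST FRAMING: constructions and kernel-checked implications over abc-iut-L2-t3's / abc-iut-L3's data structures; the parameter
class `TemperedFrobenioid T₀ (ConnectedPart (BTemp G)) VD` is inhabited for the tower models named above (their `nonempty_…` theorems)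
but NOT shown inhabited for an actual curve; [EtTh] is refereed; nothing here takes a side on [IUTchIII] Cor. 3.12; typed ≠ proved.
-/

noncomputable section

namespace Literature.AnabelianGeometry.EtaleTheta

open CategoryTheory Opposite Topology Literature.AlgebraicGeometry.Frobenioids Literature.AnabelianGeometry.SemiGraphs
  Literature.AnabelianGeometry.SemiGraphs.GaloisObjects Literature.AlgebraicGeometry.Frobenioids.QuasiTemperoid.BTempConnected

universe u₀ v₀ u w

/-! ## The Frobenius-trivial object `(G/M, 0)` over the connected Galois object `G/M` of `B^temp(G)⁰` -/

namespace TemperedFrobenioid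

variable {G : Type u} [Group G] [TopologicalSpace G] [IsTopologicalGroup G] (hG : IsTempered G)
  {D₀ : Type u₀} [Category.{v₀} D₀] {V : FrdIMonoidStub.{w}} {T₀ : RealifiedDivisorMonoids (D₀ := D₀) V}
  {VD : FrdICatStub.{u + 1, u, w} (ConnectedPart (BTemp G))}
  (tf : TemperedFrobenioid T₀ (ConnectedPart (BTemp G)) VD) (M : OpenNormalSubgroup G)

/-- `G/M` as an object of the connected part `B^temp(G)⁰` of the temperoid of a tempered group `G` ([SemiAnbd] Rmk. 3.1.2:
`Π/M` is connected).  [cite: MochizukiSemiAnbd2006, Rmk 3.1.2 p.33] -/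
def quotConnObj : ConnectedPart (BTemp G) :=
  ⟨BTemp.quotientObj G hG M.toSubgroup M.isOpen', isConnectedObj_quotientObj hG _ _⟩

/-- **`(G/M, 0)`**: the object of a tempered Frobenioid over `B^temp(G)⁰` with base `G/M` and trivial class ([FrdI] Thm. 5.2 (i);
print's `A_⊙`, "a Frobenius-trivial object … such that `A_⊙^bs` … is a Galois object", p.312 (PDF p.86)).
[cite: MochizukiEtTh2009, Def 4.1 p.312 (PDF p.86)] -/
def quotConnZeroObj : tf.category :=
  ModelFrobenioid.zeroObj tf.divisorMonoid tf.ratFnFunctor tf.divBNatTrans (quotConnObj hG M)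

/-- The base of `(G/M, 0)` (definitionally). [cite: MochizukiEtTh2009, Def 4.1 p.312 (PDF p.86)] -/
theorem quotConnZeroObj_base : (tf.quotConnZeroObj hG M).base = quotConnObj hG M := rfl

/-- **`(G/M, 0)` is Frobenius-trivial** ([FrdI] Thm. 5.2, p.101; `B` group-like by `ratFnFunctor_isGroupLike_holds`).
[cite: MochizukiFrdI2008, Thm. 5.2 p.101] -/
theorem isFrobeniusTrivial_quotConnZeroObj : PreFrobenioid.IsFrobeniusTrivial tf.toElem (tf.quotConnZeroObj hG M) :=
  ModelFrobenioid.isFrobeniusTrivial_zeroObj tf.ratFnFunctor_isGroupLike_holds _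

/-- The underlying `G`-set of the base of `(G/M, 0)` is a Galois object ([SemiAnbd] Rmk. 3.1.3).
[cite: MochizukiSemiAnbd2006, Rmk 3.1.3 p.34] -/
theorem isGaloisObj_quotConnZeroObj_base : SemiGraphs.IsGaloisObj (tf.quotConnZeroObj hG M).base.obj :=
  isGaloisObj_of_iso_quotientObj hG _ M (Iso.refl _)

end TemperedFrobenioid

/-! ## The §4 setting over `B^temp(G)⁰` for a tempered quotient `φ : Π^tp_X ↠ G` -/

namespace BiKummerSetting

variable {K : Type u₀} [Field K] (X : SemiGraphs.TemperedArithmeticGroup.{u₀} K)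
  {G : Type u} [Group G] [TopologicalSpace G] [IsTopologicalGroup G] (hG : IsTempered G)
  (φ : X.Pi →ₜ* G) (hφ : Function.Surjective φ)
  {D₀ : Type u₀} [Category.{v₀} D₀] {V : FrdIMonoidStub.{w}} {T₀ : RealifiedDivisorMonoids (D₀ := D₀) V}
  {VD : FrdICatStub.{u + 1, u, w} (ConnectedPart (BTemp G))}
  (tf : TemperedFrobenioid T₀ (ConnectedPart (BTemp G)) VD) (hZ : tf.monoidType = MonoidType.Z)
  (hP : ∀ A : (ConnectedPart (BTemp G))ᵒᵖ, IsPerfect (tf.Φ.carrier A))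
  (NH : Subgroup (Field.absoluteGaloisGroup K) → tf.category → ℕ+ → Prop)

section Setting

variable (A₀ : tf.category) (hA₀ : PreFrobenioid.IsFrobeniusTrivial tf.toElem A₀) (hA₀' : SemiGraphs.IsGaloisObj A₀.base.obj)

/-- **The §4 bi-Kummer setting over the connected temperoid `D := B^temp(G)⁰` of a tempered quotient `φ : Π^tp_X ↠ G`**
(Def. 4.1, pp.312–313 (PDF pp.86–87); Def. 3.6 (ii): `D` connected, totally epimorphic): abc-iut-L2-t9's `mkOfModelCanonical`
with Galois objects := those whose underlying `G`-set is Galois ([SemiAnbd] Def. 3.1 (iv)) and Galois surjections := "the natural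
surjective outer homomorphism `Π^tp_X ↠ Aut_D(A^bs)`" (Def. 4.1 (ii)) represented by `galoisSurjOf⁰_A ∘ φ` — the canonical
`G ↠ Aut(A)` of [SemiAnbd] Rmk. 3.1.3 on the connected part, precomposed with `φ` (surjective: `hφ`).
[cite: MochizukiEtTh2009, Def 4.1 p.313 (PDF p.87)] -/
def mkOfQuotientTemperoid : BiKummerSetting X T₀ (ConnectedPart (BTemp G)) VD :=
  mkOfModelCanonical X tf hZ hP (fun A => SemiGraphs.IsGaloisObj A.obj)
    (fun A h => (((connectedObjects (BTemp G)).fullyFaithfulι.autMulEquivOfFullyFaithful A).symm.toMonoidHom.comp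
      (galoisSurjOf hG A.obj h)).comp φ.toMonoidHom)
    (fun A h => by
      rw [MonoidHom.coe_comp]
      exact (galoisSurjOf_connectedPart_surjective hG A h).comp hφ)
    NH A₀ hA₀ hA₀'

/-- The underlying tempered Frobenioid is `tf` (definitionally). [cite: MochizukiEtTh2009, Def 4.1 p.312 (PDF p.86)] -/
theorem mkOfQuotientTemperoid_tf : (mkOfQuotientTemperoid X hG φ hφ tf hZ hP NH A₀ hA₀ hA₀').tf = tf := rfl

/-- On underlying `G`-sets the Galois surjection of the setting at `g ∈ Π^tp_X` IS `galoisSurjOf` at `φ g` (definitionally).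
[cite: MochizukiEtTh2009, Def 4.1 (ii) p.313 (PDF p.87)] -/
theorem mkOfQuotientTemperoid_galoisSurj_hom_hom (A : ConnectedPart (BTemp G))
    (hA : (mkOfQuotientTemperoid X hG φ hφ tf hZ hP NH A₀ hA₀ hA₀').IsGaloisObj A) (g : X.Pi) :
    ((mkOfQuotientTemperoid X hG φ hφ tf hZ hP NH A₀ hA₀ hA₀').galoisSurj A hA g).hom.hom =
      (galoisSurjOf hG A.obj hA (φ g)).hom :=
  rfl

/-- **The kernel of the setting's Galois surjection is `φ⁻¹(Ker(G ↠ Aut(A)))`** (the transport to the full subcategory is injective).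
[cite: MochizukiEtTh2009, Def 4.1 (ii) p.313 (PDF p.87)] -/
theorem ker_mkOfQuotientTemperoid_galoisSurj (A : ConnectedPart (BTemp G))
    (hA : (mkOfQuotientTemperoid X hG φ hφ tf hZ hP NH A₀ hA₀ hA₀').IsGaloisObj A) :
    ((mkOfQuotientTemperoid X hG φ hφ tf hZ hP NH A₀ hA₀ hA₀').galoisSurj A hA).ker =
      (galoisSurjOf hG A.obj hA).ker.comap φ.toMonoidHom := by
  ext g
  rw [MonoidHom.mem_ker, Subgroup.mem_comap, MonoidHom.mem_ker]
  change ((connectedObjects (BTemp G)).fullyFaithfulι.autMulEquivOfFullyFaithful A).symm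
      (galoisSurjOf hG A.obj hA (φ g)) = 1 ↔ _
  rw [MulEquiv.map_eq_one_iff]
  exact Iff.rfl

/-- **Def. 4.1 (ii) naturality ("natural surjective OUTER homomorphism") is a THEOREM over `B^temp(G)⁰`**: the setting satisfies
`GaloisSurjNatural` — abc-iut-w5-d013's `galoisSurjOf_natural` on the connected part, the inner conjugator `c ∈ G` being LIFTED
along the surjection `φ`.  [cite: MochizukiEtTh2009, Def 4.1 (ii) p.313 (PDF p.87)] -/
theorem mkOfQuotientTemperoid_galoisSurj_natural :
    (mkOfQuotientTemperoid X hG φ hφ tf hZ hP NH A₀ hA₀ hA₀').GaloisSurjNatural := by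
  intro A B hA hB b
  obtain ⟨c, hc⟩ := galoisSurjOf_connectedPart_natural hG hA hB b
  obtain ⟨c', rfl⟩ := hφ c
  refine ⟨c', fun g => ?_⟩
  have h := hc (φ g)
  rw [← map_inv, ← map_mul, ← map_mul] at h
  exact h

/-- **The kernel of `Π^tp_X ↠ Aut(A)` is OPEN over `B^temp(G)⁰`** (`φ` continuous; `IsOpenKerGaloisSurj`) — the §5 binder `hopen` is
a theorem here.  [cite: MochizukiEtTh2009, Def 4.1 (ii) p.313 (PDF p.87)] -/
theorem mkOfQuotientTemperoid_isOpen_ker_galoisSurj :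
    (mkOfQuotientTemperoid X hG φ hφ tf hZ hP NH A₀ hA₀ hA₀').IsOpenKerGaloisSurj := by
  intro A hA
  rw [ker_mkOfQuotientTemperoid_galoisSurj, Subgroup.coe_comap]
  exact (isOpen_ker_galoisSurjOf hG A.obj hA).preimage φ.continuous

/-- **Law (L1) «Galois objects are `Aut`-torsors over every target» over `B^temp(G)⁰`** (binder `hGalT` of the §5 Prop. 5.5 files;
[SemiAnbd] Rmk. 3.1.3) — independent of `φ`.  [cite: MochizukiSemiAnbd2006, Rmk 3.1.3 p.34] -/
theorem mkOfQuotientTemperoid_galoisHomTorsor :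
    ∀ ⦃A : ConnectedPart (BTemp G)⦄, (mkOfQuotientTemperoid X hG φ hφ tf hZ hP NH A₀ hA₀ hA₀').IsGaloisObj A →
      ∀ ⦃T' : ConnectedPart (BTemp G)⦄ (b b' : A ⟶ T'), ∃ g : Aut A, b' = g.hom ≫ b :=
  fun A hA T' b b' => GaloisObjects.exists_aut_comp_eq_of_isGaloisObj_connectedPart A T' hA b b'

/-- **`H_⊙ = φ⁻¹(Stab_G(x))` for every point `x` of `A_⊙^bs`** over `B^temp(G)⁰` (p.312 (PDF p.86): "the open subgroup determined
by `A_⊙`"; all stabilisers of a Galois object coincide).  [cite: MochizukiEtTh2009, Def 4.1 p.312 (PDF p.86)] -/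
theorem mem_Hodot_mkOfQuotientTemperoid_iff (x : A₀.base.obj.obj.V) (g : X.Pi) :
    g ∈ (mkOfQuotientTemperoid X hG φ hφ tf hZ hP NH A₀ hA₀ hA₀').Hodot ↔ A₀.base.obj.obj.ρ (φ g) x = x := by
  change g ∈ ((mkOfQuotientTemperoid X hG φ hφ tf hZ hP NH A₀ hA₀ hA₀').galoisSurj A₀.base hA₀').ker ↔ _
  rw [ker_mkOfQuotientTemperoid_galoisSurj, Subgroup.mem_comap]
  exact mem_ker_galoisSurjOf_iff_apply hG A₀.base.obj hA₀' x (φ g)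

/-- `H_⊙` is open over `B^temp(G)⁰`. [cite: MochizukiEtTh2009, Def 4.1 p.312 (PDF p.86)] -/
theorem isOpen_Hodot_mkOfQuotientTemperoid :
    IsOpen ((mkOfQuotientTemperoid X hG φ hφ tf hZ hP NH A₀ hA₀ hA₀').Hodot : Set X.Pi) :=
  mkOfQuotientTemperoid_isOpen_ker_galoisSurj X hG φ hφ tf hZ hP NH A₀ hA₀ hA₀' A₀.base hA₀'

/-- The §5 binder `hH` over `B^temp(G)⁰` holds as soon as `φ(ιX(Π^tp_Ÿ))` fixes a point of `A_⊙^bs`.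
[cite: MochizukiEtTh2009, §5 p.330 (PDF p.104)] -/
theorem hH_mkOfQuotientTemperoid_of_fixes {P : Type*} [Group P] [TopologicalSpace P] (ιX : P ≃ₜ* X.Pi) (PiYdd : Subgroup P)
    (x : A₀.base.obj.obj.V) (hfix : ∀ y : P, y ∈ PiYdd → A₀.base.obj.obj.ρ (φ (ιX y)) x = x) :
    ∀ y : P, y ∈ PiYdd → ιX y ∈ (mkOfQuotientTemperoid X hG φ hφ tf hZ hP NH A₀ hA₀ hA₀').Hodot :=
  fun y hy => (mem_Hodot_mkOfQuotientTemperoid_iff X hG φ hφ tf hZ hP NH A₀ hA₀ hA₀' x (ιX y)).2 (hfix y hy)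

end Setting

/-! ## Dictionary: at `G := Π^tp_X`, `φ := id` this IS the setting over the genuine connected base -/

section Identity

variable {VD' : FrdICatStub.{u₀ + 1, u₀, w} (ConnectedPart (BTemp X.Pi))}
  (tf' : TemperedFrobenioid T₀ (ConnectedPart (BTemp X.Pi)) VD') (hZ' : tf'.monoidType = MonoidType.Z)
  (hP' : ∀ A : (ConnectedPart (BTemp X.Pi))ᵒᵖ, IsPerfect (tf'.Φ.carrier A))
  (NH' : Subgroup (Field.absoluteGaloisGroup K) → tf'.category → ℕ+ → Prop)
  (A₀ : tf'.category) (hA₀ : PreFrobenioid.IsFrobeniusTrivial tf'.toElem A₀) (hA₀' : SemiGraphs.IsGaloisObj A₀.base.obj)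

/-- **`mkOfQuotientTemperoid` at the identity `Π^tp_X → Π^tp_X` is abc-iut-L2-t4's `mkOfConnectedTemperoid`** (definitionally) —
so everything proved over the genuine connected base is the case `φ := id` of this file.  [cite: MochizukiEtTh2009, Def 4.1 p.313 (PDF p.87)] -/
theorem mkOfQuotientTemperoid_id :
    mkOfQuotientTemperoid X X.isTempered (ContinuousMonoidHom.id X.Pi) Function.surjective_id tf' hZ' hP' NH' A₀ hA₀ hA₀' =
      mkOfConnectedTemperoid X tf' hZ' hP' NH' A₀ hA₀ hA₀' :=
  rfl

end Identity

/-! ## The canonical `A_⊙ := (G/M, 0)`; the §5 choice `M := φ(ιX(Π^tp_Ÿ))` -/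

section Quot

variable (M : OpenNormalSubgroup G)

/-- **The setting over `B^temp(G)⁰` with `A_⊙ := (G/M, 0)`.** [cite: MochizukiEtTh2009, Def 4.1 p.312 (PDF p.86)] -/
def mkOfQuotientTemperoidQuot : BiKummerSetting X T₀ (ConnectedPart (BTemp G)) VD :=
  mkOfQuotientTemperoid X hG φ hφ tf hZ hP NH (tf.quotConnZeroObj hG M) (tf.isFrobeniusTrivial_quotConnZeroObj hG M)
    (tf.isGaloisObj_quotConnZeroObj_base hG M)

/-- **`H_⊙ = φ⁻¹(M)`** for `A_⊙ := (G/M, 0)` (membership). [cite: MochizukiEtTh2009, Def 4.1 p.312 (PDF p.86)] -/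
theorem mem_Hodot_mkOfQuotientTemperoidQuot_iff (g : X.Pi) :
    g ∈ (mkOfQuotientTemperoidQuot X hG φ hφ tf hZ hP NH M).Hodot ↔ φ g ∈ M := by
  rw [mkOfQuotientTemperoidQuot, mem_Hodot_mkOfQuotientTemperoid_iff X hG φ hφ tf hZ hP NH (tf.quotConnZeroObj hG M)
    (tf.isFrobeniusTrivial_quotConnZeroObj hG M) (tf.isGaloisObj_quotConnZeroObj_base hG M) ((1 : G) : G ⧸ M.toSubgroup) g]
  exact quotientObj_ρ_one_eq_iff hG M.toSubgroup M.isOpen' (φ g)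

/-- **`H_⊙ = φ⁻¹(M)`** for `A_⊙ := (G/M, 0)`. [cite: MochizukiEtTh2009, Def 4.1 p.312 (PDF p.86)] -/
theorem Hodot_mkOfQuotientTemperoidQuot :
    (mkOfQuotientTemperoidQuot X hG φ hφ tf hZ hP NH M).Hodot = M.toSubgroup.comap φ.toMonoidHom :=
  Subgroup.ext (mem_Hodot_mkOfQuotientTemperoidQuot_iff X hG φ hφ tf hZ hP NH M)

/-- **The §5 binder `hH` (`Π^tp_Ÿ ⊆ H_⊙`) for `A_⊙ := (G/M, 0)` whenever `φ(ιX(Π^tp_Ÿ)) ⊆ M`.**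
[cite: MochizukiEtTh2009, §5 p.330 (PDF p.104)] -/
theorem hH_mkOfQuotientTemperoidQuot_of_forall_mem {P : Type*} [Group P] [TopologicalSpace P] (ιX : P ≃ₜ* X.Pi)
    (PiYdd : Subgroup P) (hM : ∀ y : P, y ∈ PiYdd → φ (ιX y) ∈ M) :
    ∀ y : P, y ∈ PiYdd → ιX y ∈ (mkOfQuotientTemperoidQuot X hG φ hφ tf hZ hP NH M).Hodot :=
  fun y hy => (mem_Hodot_mkOfQuotientTemperoidQuot_iff X hG φ hφ tf hZ hP NH M (ιX y)).2 (hM y hy)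

end Quot

section Ydd

variable {N : ℕ+} (T : ThetaEnvData.{max u w} N) (ιX : T.PiX ≃ₜ* X.Pi)
  (hopenY : IsOpen (φ.toMonoidHom '' (ιX.toMonoidHom '' (T.PiYdd : Set T.PiX))))

/-- The image `φ(ιX(Π^tp_Ÿ)) ⊆ G` as an open normal subgroup (normal because `φ` is onto; open by the input `hopenY` — automatic
when `G` carries the quotient topology of `φ`).  [cite: MochizukiEtTh2009, §5 p.330 (PDF p.104)] -/
def yddImage : OpenNormalSubgroup G :=
  haveI := T.PiYdd_normal
  { toSubgroup := (T.PiYdd.map ιX.toMonoidHom).map φ.toMonoidHom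
    isOpen' := by
      change IsOpen (((T.PiYdd.map ιX.toMonoidHom).map φ.toMonoidHom : Subgroup G) : Set G)
      rwa [Subgroup.coe_map, Subgroup.coe_map]
    isNormal' := (T.PiYdd_normal.map ιX.toMonoidHom ιX.surjective).map φ.toMonoidHom hφ }

omit [IsTopologicalGroup G] in
/-- Membership in `φ(ιX(Π^tp_Ÿ))`. [cite: MochizukiEtTh2009, §5 p.330 (PDF p.104)] -/
theorem mem_yddImage_iff (g : G) :
    g ∈ (yddImage X φ hφ T ιX hopenY).toSubgroup ↔ ∃ y ∈ T.PiYdd, φ (ιX y) = g := by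
  change g ∈ (T.PiYdd.map ιX.toMonoidHom).map φ.toMonoidHom ↔ _
  constructor
  · rintro ⟨_, ⟨y, hy, rfl⟩, rfl⟩
    exact ⟨y, hy, rfl⟩
  · rintro ⟨y, hy, rfl⟩
    exact ⟨ιX y, ⟨y, hy, rfl⟩, rfl⟩

include hG hφ in
omit [IsTopologicalGroup G] in
/-- **The input `hopenY` DISCHARGED for first-countable groups**: a continuous surjection between first-countable tempered groups is an
OPEN map (the tree's open mapping theorem `IsTempered.isOpenMap_of_surjective_of_isTempered`, Baire + completeness), so the image
`φ(ιX(Π^tp_Ÿ))` of the open subgroup `Π^tp_Ÿ` is open in `G` (`Π^tp_X` is Galois-countable — [IUTchI] Rmk. 2.5.3 (i), field `secondCountableTopology`; e.g. `G ≤ Ẑ(1)³ ⋊ (Ẑˣ × ℤ)` metrisable).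
[cite: MochizukiSemiAnbd2006, Def 3.1(i) p.33] -/
theorem isOpen_yddImage_of_firstCountable [IsTopologicalGroup G] [FirstCountableTopology G] :
    IsOpen (φ.toMonoidHom '' (ιX.toMonoidHom '' (T.PiYdd : Set T.PiX))) :=
  haveI := X.secondCountableTopology
  X.isTempered.isOpenMap_of_surjective_of_isTempered hG φ.toMonoidHom φ.continuous hφ _ (ιX.isOpenMap _ T.PiYdd_open)

/-- **The §5 setting over `B^temp(G)⁰` with `A_⊙^bs := Ÿ` read in `G`**: `A_⊙ := (G/φ(ιX(Π^tp_Ÿ)), 0)`.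
[cite: MochizukiEtTh2009, §5 p.330 (PDF p.104)] -/
def mkOfQuotientTemperoidYdd : BiKummerSetting X T₀ (ConnectedPart (BTemp G)) VD :=
  mkOfQuotientTemperoidQuot X hG φ hφ tf hZ hP NH (yddImage X φ hφ T ιX hopenY)

/-- **`H_⊙ = φ⁻¹(φ(ιX(Π^tp_Ÿ)))`** for the §5 choice (membership). [cite: MochizukiEtTh2009, §5 p.330 (PDF p.104)] -/
theorem mem_Hodot_mkOfQuotientTemperoidYdd_iff (g : X.Pi) :
    g ∈ (mkOfQuotientTemperoidYdd X hG φ hφ tf hZ hP NH T ιX hopenY).Hodot ↔ ∃ y ∈ T.PiYdd, φ (ιX y) = φ g := by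
  rw [mkOfQuotientTemperoidYdd, mem_Hodot_mkOfQuotientTemperoidQuot_iff]
  exact mem_yddImage_iff X φ hφ T ιX hopenY (φ g)

/-- **The §5 binder `hH` (`Π^tp_Ÿ ⊆ H_⊙`) is a THEOREM for `A_⊙^bs := Ÿ` over `B^temp(G)⁰`.** [cite: MochizukiEtTh2009, §5 p.330 (PDF p.104)] -/
theorem hH_mkOfQuotientTemperoidYdd :
    ∀ y : T.PiX, y ∈ T.PiYdd → ιX y ∈ (mkOfQuotientTemperoidYdd X hG φ hφ tf hZ hP NH T ιX hopenY).Hodot :=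
  fun y hy => (mem_Hodot_mkOfQuotientTemperoidYdd_iff X hG φ hφ tf hZ hP NH T ιX hopenY (ιX y)).2 ⟨y, hy, rfl⟩

/-- `Ker φ ⊆ H_⊙` for the §5 choice: the setting over `B^temp(G)⁰` only sees `Π^tp_X` through `G` (the honest content of the
re-basing).  [cite: MochizukiEtTh2009, §5 p.330 (PDF p.104)] -/
theorem ker_le_Hodot_mkOfQuotientTemperoidYdd :
    φ.toMonoidHom.ker ≤ (mkOfQuotientTemperoidYdd X hG φ hφ tf hZ hP NH T ιX hopenY).Hodot := by
  intro g hg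
  rw [mem_Hodot_mkOfQuotientTemperoidYdd_iff]
  refine ⟨1, T.PiYdd.one_mem, ?_⟩
  rw [map_one, map_one]
  exact (MonoidHom.mem_ker.mp hg).symm

end Ydd

end BiKummerSetting

end Literature.AnabelianGeometry.EtaleTheta

end
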